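import Mathlib.Combinatorics.SimpleGraph.Coloring.Constructions
import Literature.Barriers.Parity.SignGhost
import HarnessLib

/-!
# Barrier (Parity / GeneralizedHardyLittlewood): the parity obstruction for DISJUNCTIONS of
# prime-pair problems — a sign-pattern ghost exists exactly for the bipartite target graphs
# (Polymath 2014 §8 and Remark 8.1, from the edge and the path to an arbitrary target graph)

`Literature/Barriers/Parity/TargetGraphParity.lean` — barrier catalogue entry (D-0021) for the
summit `Parity`, sub-problem `GeneralizedHardyLittlewood`, extending
`Literature.Barriers.Parity.PrimePairParity` (the edge `{n, n + 2}` and Polymath's path `0–2–6`)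
to an arbitrary TARGET GRAPH `T` on `k` shifted forms `n + h i`, and to the threshold targets
"at least `m` of the `k` forms are prime". The catalogued declaration is `TargetGraphParity`
(docstring = BARRIER block), PROVED (`TargetGraphParity_holds`); every theorem in this file is
proved and the file introduces no named fact. The graph half of the content (the ghost LP
`HasSignGhost`, the criterion `hasSignGhost_iff_colorable_two`, the schema `signGhost_schema`)
lives in the companion file `SignGhost.lean`; this file adds the threshold LP
(`HasThresholdGhost`, `hasThresholdGhost_iff_add_two_le`, `thresholdGhost_schema`), the cycle
calibration (`hasSignGhost_cycleGraph_iff`: `C_n` is obstructed iff `n` is even, so the pentagon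
is ghost-free) and assembles the catalogue entry.

## Setting (Polymath 2014, §8)

A lower bound `∑_n ν(n) 1_A(n) > 0` is *sieve-theoretic* relative to a class of distributional
inputs if "an inspection of these arguments reveals that they would be equally valid if one
inserted a further non-negative weight `ω`" enjoying the same (weighted) inputs
[cite: Polymath8b2014, §8 (8.3)–(8.6)] — the technique class
`Literature.Barriers.Parity.IsSieveTheoreticDeduction Inputs A` of `PrimePairParity.lean`.
Polymath kill `H₁ = 2` and `H₁ ≤ 4` with the weights `1 - λ(n)λ(n+2)` and
`(1 - λ(n)λ(n+2))(1 - λ(n+2)λ(n+6))` ("Observe that `ω` vanishes for any `n ∈ A'`, and hence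
`∑_n ν(n) 1_{A'}(n) ω(n) = 0` for any `ν`", (8.9)), print in Remark 8.1 the product weight
`∏ (1 - λ(n+i)λ(n+i'))` over a pair GRAPH on the shifts `0, …, H`, and note that `H₁ ≤ 6`
(`{0, 2, 6}`, "at least two of `n, n+2, n+6` are prime" — a triangle) is NOT obstructed
[cite: Polymath8b2014, §8 (pp. 35–36) and Remark 8.1]. All these weights are functions `P ≥ 0`
of the SIGN PATTERN `ε i = [λ(n + h i) = -1]` (`signPatternWeight P h`); such a weight
annihilates the target set `edgePrimeSet T h = {n | some edge ij of T has n + h i, n + h j prime}`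
as soon as `P` vanishes on the patterns whose `true`-set contains an edge of `T` (`λ(p) = -1`),
and then defeats every weight-insertion-invariant deduction (`signGhost_schema`). The frame asks
in addition for balanced one-variable marginals (no degree-one Walsh mass: the part of `ω` seen
by one-prime distributional inputs) and positive mass: the ghost LP `HasSignGhost T`.

## What is proved here and in `SignGhost.lean`

* `hasSignGhost_iff_colorable_two` (companion file): a sign ghost exists iff `T` is
  2-colourable. Normalised, a ghost is a probability measure on `T`-independent `true`-sets with
  all vertex marginals `½`, i.e. the point `(½, …, ½)` of the stable-set polytope of `T`; the
  incidence vectors of stable sets satisfy the odd-circuit inequalities `x(C) ≤ (|C| - 1)/2`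
  [cite: Toft1995HandbookColouring, §8, inequalities (a)–(d) before Thm 8.12], violated by
  `(½, …, ½)` on an odd circuit, while for bipartite `T` the two colour classes give the cut
  ghost. So twins, every single pair `{n, n + d}`, paths, stars, trees, even cycles and Polymath's
  `A'` are obstructed by a FIXED sign ghost; triangles, pentagons, `K_k` (`k ≥ 3`) are not
  (`hasSignGhost_cycleGraph_iff`, `not_hasSignGhost_cycleGraph_five`,
  `not_hasSignGhost_top_three`). Remark 8.1 of the source treats `A_H` (two primes at distance
  `≤ 4` in `[n, n + H]`) with a product weight RESTRICTED to shifts `i, i'` with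
  `(n + i, 3) = (n + i', 3) = 1`, i.e. depending on `n (mod 3)`: the fixed distance-`≤ 4` pair
  graph on `{0, …, H}` contains the triangle `{0, 2, 4}` and has no fixed sign ghost, so such
  congruence-restricted ghosts lie beyond conjunct (1) (see `scope_caveats`).
* `hasThresholdGhost_iff_add_two_le` (here): for the target "at least `m` of the `k` forms
  prime" (the sets behind `DHL[k, m]`, [cite: Polymath8b2014, Claim 3.1]) a sign ghost — `P ≥ 0`
  of positive mass, vanishing on the patterns with `≥ m` trues, balanced marginals — exists iff
  `k + 2 ≤ 2m`: `⇒` by double counting (balanced marginals give `P`-average `true`-count `k/2`,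
  the support has `true`-count `≤ m - 1`); `⇐` by the flip-symmetric weight
  `1[#true < m ∧ #false < m]`. This is the exact form, inside the sign-ghost frame, of "the parity
  phenomenon means that we cannot hope to prove `k/2` of our linear functions are simultaneously
  prime based on a sieve argument" [cite: Maynard2019GapsICM, §6]: `m` of `k` is obstructed iff
  `m ≥ k/2 + 1`; consistently `DHL[3,2]` (GEH, [cite: Polymath8b2014, Theorem 3.2 (xii)]),
  `DHL[50,2]` (unconditional, Theorem 3.2 (i)) are ghost-free, and so is `DHL[5,3]`.
* `thresholdGhost_schema` (here), `signGhost_schema` (companion): the weight-insertion schema of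
  `PrimePairParity_holds`, verbatim, for the general targets.

## Design notes

* Imports: `SignGhost` (hence `PrimePairParity`: `liouvilleR`, `weightedDetectionSum`,
  `IsSieveTheoreticDeduction`; and `HasSignGhost`, `signPatternWeight`, `edgePrimeSet`,
  `flipPattern`, `sum_ite_eq_of_flip_invariant`) and Mathlib's colouring constructions
  (`cycleGraph.bicoloring_of_even`, `cycleGraph.cycle`). No Summits import.
* Conjuncts (2) and (4) of `TargetGraphParity` are written in the literal inline form of the
  (retired) route items `stmt-Parity-4346` (`GhostSchema`) — `fun n => P (fun i => decide
  (liouvilleR (n + h i) = -1))` and the set-builder target — which is `signPatternWeight P h` /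
  `edgePrimeSet T h` / `thresholdPrimeSet m h` unfolded; (1) and (3) use the LP predicates
  `HasSignGhost` (literal body of `stmt-Parity-4345`) and `HasThresholdGhost` (literal body of
  `stmt-Parity-4349`).
* What is NOT here: which input classes `Inputs` the ghosts actually satisfy — the conjectural
  Möbius-randomness half of §8 (the unproved predictions
  `Polymath2014_liouvilleShiftAPConjecture`, `Polymath2014_liouvillePairAP` registered in
  `PrimePairParity.lean`); congruence-restricted ghosts à la Remark 8.1; general hypergraph
  targets; affine forms `a i * n + b i`; any claim that ghost-free targets ARE sieve-accessible.
-/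

noncomputable section

open Finset

namespace Literature.Barriers.Parity

/-! ### The threshold ghost LP: "at least `m` of the `k` forms prime" -/

/-- **Threshold ghost.** `HasThresholdGhost k m` says that the ghost linear programme of the
threshold target "at least `m` of the `k` forms `n + h i` are prime" is feasible: there is a
function `P` of the sign pattern `ε : Fin k → Bool` (`true` = "`λ(n + h i) = -1`") which is
non-negative, has positive total mass, vanishes on every pattern with at least `m` coordinates
`true` (so that `signPatternWeight P h` annihilates `thresholdPrimeSet m h`), and has balanced
one-variable marginals. Stated literally as inlined in the retired route item
`ManyPrimesThreshold` (`stmt-Parity-4349`). Equivalent to `k + 2 ≤ 2 * m`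
(`hasThresholdGhost_iff_add_two_le`). [folklore] -/
def HasThresholdGhost (k m : ℕ) : Prop :=
  ∃ P : (Fin k → Bool) → ℝ, (∀ ε, 0 ≤ P ε) ∧ 0 < ∑ ε, P ε ∧
    (∀ ε, m ≤ (univ.filter fun i => ε i = true).card → P ε = 0) ∧
    ∀ i, ∑ ε, (if ε i then P ε else 0) = ∑ ε, (if ε i then 0 else P ε)

/-- Unfolding lemma for `HasThresholdGhost` (definitional). [folklore] -/
theorem hasThresholdGhost_iff (k m : ℕ) :
    HasThresholdGhost k m ↔
      ∃ P : (Fin k → Bool) → ℝ, (∀ ε, 0 ≤ P ε) ∧ 0 < ∑ ε, P ε ∧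
        (∀ ε, m ≤ (univ.filter fun i => ε i = true).card → P ε = 0) ∧
        ∀ i, ∑ ε, (if ε i then P ε else 0) = ∑ ε, (if ε i then 0 else P ε) :=
  Iff.rfl

/-- Column sum of the marginal table: `∑_i 1[ε i] P ε = #{i : ε i} · P ε`. [folklore] -/
theorem sum_ite_apply_eq_card_mul {k : ℕ} (P : (Fin k → Bool) → ℝ) (ε : Fin k → Bool) :
    ∑ i, (if ε i then P ε else 0) = ((univ.filter fun i => ε i = true).card : ℝ) * P ε := by
  calc ∑ i, (if ε i then P ε else 0) = ∑ _i ∈ univ.filter (fun i => ε i = true), P ε :=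
        (Finset.sum_filter _ _).symm
    _ = ((univ.filter fun i => ε i = true).card : ℝ) * P ε := by
        rw [Finset.sum_const, nsmul_eq_mul]

/-- Balanced marginals: each one-variable marginal is half the total mass. [folklore] -/
theorem two_mul_marginal_eq_mass {k : ℕ} (P : (Fin k → Bool) → ℝ)
    (hbal : ∀ i, ∑ ε, (if ε i then P ε else 0) = ∑ ε, (if ε i then 0 else P ε)) (i : Fin k) :
    2 * ∑ ε, (if ε i then P ε else 0) = ∑ ε, P ε := by
  have hsum : ∑ ε, (if ε i then P ε else 0) + ∑ ε, (if ε i then 0 else P ε) = ∑ ε, P ε := by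
    rw [← Finset.sum_add_distrib]
    refine Finset.sum_congr rfl fun ε _ => ?_
    split_ifs <;> simp
  have := hbal i
  linarith

/-- The `true`-count of the flipped pattern: `#{i : ¬ ε i} + #{i : ε i} = k`. [folklore] -/
theorem card_filter_flipPattern_add {k : ℕ} (ε : Fin k → Bool) :
    (univ.filter fun i => flipPattern ε i = true).card +
      (univ.filter fun i => ε i = true).card = k := by
  have h1 : (univ.filter fun i => flipPattern ε i = true) =
      univ.filter fun i => ¬ (ε i = true) := by
    ext i; simp
  rw [h1, add_comm, Finset.card_filter_add_card_filter_not, Finset.card_univ, Fintype.card_fin]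

/-- **`⇒`: a threshold ghost forces `k + 2 ≤ 2m`.** Double counting: by the balanced marginals
the `P`-weighted number of `true` coordinates is `k/2` times the (positive) mass, while on the
support of `P` every pattern has at most `m - 1` `true` coordinates; hence `k/2 ≤ m - 1`.
[folklore] -/
theorem HasThresholdGhost.add_two_le {k m : ℕ} (hG : HasThresholdGhost k m) : k + 2 ≤ 2 * m := by
  obtain ⟨P, hP0, hpos, hkill, hbal⟩ := hG
  -- double counting: `∑_ε #true(ε) · P ε = (k/2) · mass`
  have hswap :
      ∑ ε, ((univ.filter fun i => ε i = true).card : ℝ) * P ε = (k : ℝ) / 2 * ∑ ε, P ε := by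
    calc ∑ ε, ((univ.filter fun i => ε i = true).card : ℝ) * P ε
          = ∑ ε, ∑ i, (if ε i then P ε else 0) :=
            Finset.sum_congr rfl fun ε _ => (sum_ite_apply_eq_card_mul P ε).symm
      _ = ∑ i, ∑ ε, (if ε i then P ε else 0) := Finset.sum_comm
      _ = ∑ _i : Fin k, (∑ ε, P ε) / 2 :=
            Finset.sum_congr rfl fun i _ => by
              have := two_mul_marginal_eq_mass P hbal i
              linarith
      _ = (k : ℝ) / 2 * ∑ ε, P ε := by
            rw [Finset.sum_const, Finset.card_univ, Fintype.card_fin, nsmul_eq_mul]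
            ring
  -- pointwise: on the support, `#true(ε) ≤ m - 1`
  have hpt : ∀ ε, ((univ.filter fun i => ε i = true).card : ℝ) * P ε ≤ ((m : ℝ) - 1) * P ε := by
    intro ε
    by_cases hm : m ≤ (univ.filter fun i => ε i = true).card
    · simp [hkill ε hm]
    · refine mul_le_mul_of_nonneg_right ?_ (hP0 ε)
      have hlt : (univ.filter fun i => ε i = true).card < m := Nat.lt_of_not_le hm
      have hle : (((univ.filter fun i => ε i = true).card : ℕ) : ℝ) + 1 ≤ (m : ℝ) := by
        exact_mod_cast Nat.succ_le_of_lt hlt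
      linarith
  have hsum := Finset.sum_le_sum fun ε (_ : ε ∈ (univ : Finset (Fin k → Bool))) => hpt ε
  rw [hswap, ← Finset.mul_sum] at hsum
  have hk : (k : ℝ) / 2 ≤ (m : ℝ) - 1 := le_of_mul_le_mul_right hsum hpos
  have hk' : (k : ℝ) + 2 ≤ 2 * (m : ℝ) := by linarith
  exact_mod_cast hk'

/-- **`⇐`: threshold ghosts exist when `k + 2 ≤ 2m`** — the flip-symmetric weight
`P = 1[#true(ε) < m ∧ #false(ε) < m]`: it kills the patterns with `≥ m` trues by definition, is
invariant under the global sign flip (hence has balanced marginals), and has positive mass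
because a pattern with `⌊k/2⌋` trues has `⌊k/2⌋ < m` trues and `⌈k/2⌉ < m` falses exactly when
`k + 2 ≤ 2m` (for `k = 2r` this contains the uniform measure on `r`-sets, for `k = 2r + 1` the
sizes `r, r + 1`). [folklore] -/
theorem HasThresholdGhost.of_add_two_le {k m : ℕ} (hkm : k + 2 ≤ 2 * m) :
    HasThresholdGhost k m := by
  classical
  obtain ⟨P, hP⟩ : ∃ P : (Fin k → Bool) → ℝ, ∀ ε, P ε =
      if (univ.filter fun i => ε i = true).card < m ∧
          (univ.filter fun i => flipPattern ε i = true).card < m then 1 else 0 :=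
    ⟨_, fun _ => rfl⟩
  have hP0 : ∀ ε, 0 ≤ P ε := fun ε => by rw [hP ε]; split_ifs <;> norm_num
  refine ⟨P, hP0, ?_, ?_, ?_⟩
  · -- positive mass: a pattern with `⌊k/2⌋` trues lies in the support
    obtain ⟨t, -, ht⟩ := Finset.exists_subset_card_eq (s := (univ : Finset (Fin k))) (n := k / 2)
      (by rw [Finset.card_univ, Fintype.card_fin]; exact Nat.div_le_self k 2)
    obtain ⟨ε₀, hε₀⟩ : ∃ ε₀ : Fin k → Bool, ∀ i, ε₀ i = decide (i ∈ t) := ⟨_, fun _ => rfl⟩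
    have hc : (univ.filter fun i => ε₀ i = true).card = k / 2 := by
      rw [← ht]
      congr 1
      ext i
      simp [hε₀]
    have hcf := card_filter_flipPattern_add ε₀
    have h1 : (univ.filter fun i => ε₀ i = true).card < m := by omega
    have h2 : (univ.filter fun i => flipPattern ε₀ i = true).card < m := by omega
    have hε₀P : P ε₀ = 1 := by rw [hP ε₀]; exact if_pos ⟨h1, h2⟩
    exact Finset.sum_pos' (fun ε _ => hP0 ε) ⟨ε₀, Finset.mem_univ _, by rw [hε₀P]; norm_num⟩
  · -- kills every pattern with at least `m` trues
    intro ε hm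
    rw [hP ε]
    exact if_neg fun h => absurd h.1 (not_lt.mpr hm)
  · -- balanced marginals, from the flip symmetry
    refine sum_ite_eq_of_flip_invariant P (fun ε => ?_)
    rw [hP, hP, flipPattern_flipPattern]
    exact if_congr and_comm rfl rfl

/-- **Threshold criterion.** A sign ghost for "at least `m` of the `k` forms prime" exists iff
`k + 2 ≤ 2m`, i.e. iff `m ≥ k/2 + 1` (the retired route item `ManyPrimesThreshold`,
`stmt-Parity-4349`, whose inline LP is `HasThresholdGhost`): the precise form, in the sign-ghost
frame, of
"we cannot hope to prove `k/2` of our linear functions are simultaneously prime based on a sieve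
argument" [cite: Maynard2019GapsICM, §6]. -/
theorem hasThresholdGhost_iff_add_two_le (k m : ℕ) : HasThresholdGhost k m ↔ k + 2 ≤ 2 * m :=
  ⟨HasThresholdGhost.add_two_le, HasThresholdGhost.of_add_two_le⟩

/-- Calibration: twins ("2 of 2") are threshold-obstructed. [folklore] -/
theorem hasThresholdGhost_two_two : HasThresholdGhost 2 2 :=
  (hasThresholdGhost_iff_add_two_le 2 2).2 (by norm_num)

/-- Calibration: "2 of 3" (`DHL[3,2]`, proved under GEH in [Polymath8b2014, Theorem 3.2 (xii)],
whence `H₁ ≤ 6`) is ghost-free — consistent with §8 of the source, which obstructs `H₁ ≤ 4` but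
not `H₁ ≤ 6`. [cite: Polymath8b2014, Theorem 3.2 (xii) and §8 (p. 35)] -/
theorem not_hasThresholdGhost_three_two : ¬ HasThresholdGhost 3 2 := fun h =>
  absurd h.add_two_le (by norm_num)

/-- Calibration: "3 of 5" (`DHL[5,3]`) is ghost-free. [folklore] -/
theorem not_hasThresholdGhost_five_three : ¬ HasThresholdGhost 5 3 := fun h =>
  absurd h.add_two_le (by norm_num)

/-- Calibration: "3 of 4" is obstructed. [folklore] -/
theorem hasThresholdGhost_four_three : HasThresholdGhost 4 3 :=
  (hasThresholdGhost_iff_add_two_le 4 3).2 (by norm_num)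

/-! ### The threshold target set and its weight-insertion schema -/

/-- **The threshold target set** of shifts `h : Fin k → ℕ` at level `m`:
`{n | at least m of the numbers n + h i are prime}` — the set whose infinitude (for every
admissible tuple) is the weak Dickson–Hardy–Littlewood claim `DHL[k, m]`.
[cite: Polymath8b2014, Claim 3.1] -/
def thresholdPrimeSet {k : ℕ} (m : ℕ) (h : Fin k → ℕ) : Set ℕ :=
  {n | m ≤ (univ.filter fun i => (n + h i).Prime).card}

/-- Membership in `thresholdPrimeSet` (definitional). [folklore] -/
theorem mem_thresholdPrimeSet {k : ℕ} {m : ℕ} {h : Fin k → ℕ} {n : ℕ} :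
    n ∈ thresholdPrimeSet m h ↔ m ≤ (univ.filter fun i => (n + h i).Prime).card :=
  Iff.rfl

/-- **The threshold ghost annihilates the threshold target set**: at a prime `λ = -1`, so the
sign pattern of `n ∈ thresholdPrimeSet m h` has at least `m` coordinates `true`, where `P`
vanishes. [cite: Polymath8b2014, §8 (8.9)] -/
theorem signPatternWeight_eq_zero_of_threshold {k m : ℕ} {P : (Fin k → Bool) → ℝ}
    (hkill : ∀ ε, m ≤ (univ.filter fun i => ε i = true).card → P ε = 0) {h : Fin k → ℕ} {n : ℕ}
    (hn : n ∈ thresholdPrimeSet m h) : signPatternWeight P h n = 0 := by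
  refine hkill _ (hn.trans (Finset.card_le_card fun i hi => ?_))
  simp only [Finset.mem_filter, Finset.mem_univ, true_and] at hi ⊢
  exact signPattern_of_prime hi

/-- For EVERY sieve weight `ν` and every scale, the ghost-weighted detection sum of the threshold
target vanishes ((8.9) of the source, for the threshold target). [cite: Polymath8b2014, §8 (8.9)] -/
theorem weightedDetectionSum_signPatternWeight_threshold {k m : ℕ} {P : (Fin k → Bool) → ℝ}
    (hkill : ∀ ε, m ≤ (univ.filter fun i => ε i = true).card → P ε = 0) (h : Fin k → ℕ)
    (ν : ℕ → ℝ) (x : ℕ) :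
    weightedDetectionSum ν (thresholdPrimeSet m h) (signPatternWeight P h) x = 0 := by
  classical
  refine Finset.sum_eq_zero fun n _ => ?_
  by_cases hn : n ∈ thresholdPrimeSet m h
  · rw [signPatternWeight_eq_zero_of_threshold hkill hn, mul_zero]
  · rw [Set.indicator_of_notMem hn, mul_zero, zero_mul]

/-- **Threshold ghost schema** (the threshold analogue of `signGhost_schema` and of
`PrimePairParity_holds`): for every `P ≥ 0` vanishing on the patterns with at least `m` trues,
the weight `ω = signPatternWeight P h` defeats every weight-insertion-invariant deduction of
"at least `m` of the `n + h i` prime" relative to any input class that `ω` satisfies — every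
`ω`-weighted detection sum is `0`. [cite: Polymath8b2014, §8 (pp. 35–36)] -/
theorem thresholdGhost_schema (k m : ℕ) (h : Fin k → ℕ) (P : (Fin k → Bool) → ℝ)
    (hP : ∀ ε, 0 ≤ P ε) (hkill : ∀ ε, m ≤ (univ.filter fun i => ε i = true).card → P ε = 0)
    (Inputs : (ℕ → ℝ) → Prop) (hIn : Inputs (signPatternWeight P h)) :
    ¬ IsSieveTheoreticDeduction Inputs (thresholdPrimeSet m h) := by
  intro hded
  obtain ⟨x, ν, -, hpos⟩ := hded _ (signPatternWeight_nonneg hP h) hIn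
  rw [weightedDetectionSum_signPatternWeight_threshold hkill] at hpos
  exact lt_irrefl 0 hpos

/-! ### Cycle calibration: `C_n` is obstructed iff `n` is even -/

/-- Even cycles carry a sign ghost (they are bipartite: Mathlib's
`SimpleGraph.cycleGraph.bicoloring_of_even`). [folklore] -/
theorem hasSignGhost_cycleGraph_of_even {n : ℕ} (hn : Even n) :
    HasSignGhost (SimpleGraph.cycleGraph n) :=
  HasSignGhost.of_colorable_two
    (by simpa using (SimpleGraph.cycleGraph.bicoloring_of_even n hn).colorable)

/-- Odd cycles `C_{n+3}` carry NO sign ghost: the cycle itself is a closed walk of odd length,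
which a 2-colourable graph cannot have. [folklore] -/
theorem not_hasSignGhost_cycleGraph_of_odd (n : ℕ) (hodd : Odd (n + 3)) :
    ¬ HasSignGhost (SimpleGraph.cycleGraph (n + 3)) := by
  intro hG
  have heven := SimpleGraph.two_colorable_iff_forall_loop_even.mp hG.colorable_two 0
    (SimpleGraph.cycleGraph.cycle n)
  rw [SimpleGraph.cycleGraph.length_cycle] at heven
  exact (Nat.not_even_iff_odd.mpr hodd) heven

/-- **Cycle criterion**: the target graph `C_{n+3}` ("two cyclically adjacent forms prime")
carries a sign ghost iff `n + 3` is even. [folklore] -/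
theorem hasSignGhost_cycleGraph_iff (n : ℕ) :
    HasSignGhost (SimpleGraph.cycleGraph (n + 3)) ↔ Even (n + 3) := by
  refine ⟨fun hG => ?_, hasSignGhost_cycleGraph_of_even⟩
  by_contra hodd
  exact not_hasSignGhost_cycleGraph_of_odd n (Nat.not_even_iff_odd.mp hodd) hG

/-- **The pentagon is ghost-free**: no fixed sign-pattern parity ghost obstructs "some two
cyclically adjacent forms among five are both prime" — the first odd cycle after the triangle
(whose target "2 of `{n, n+2, n+6}`" is `DHL[3,2]`, proved under GEH in
[Polymath8b2014, Theorem 3.2 (xii)]); nothing is claimed here about its accessibility.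
[folklore] -/
theorem not_hasSignGhost_cycleGraph_five : ¬ HasSignGhost (SimpleGraph.cycleGraph 5) :=
  not_hasSignGhost_cycleGraph_of_odd 2 (by decide)

/-! ### The barrier -/

/-- **Barrier: fixed sign-pattern parity ghosts obstruct exactly the bipartite target graphs
(Polymath 2014 §8, generalised from the edge and the path to an arbitrary target graph;
threshold form after Maynard's `k/2` remark).** For `k` shifted forms `n + h i` and a target
graph `T` on `Fin k`, a sign-pattern parity ghost — a weight `ω(n) = P([λ(n + h i) = -1]_i)` with
`P ≥ 0` of positive mass, vanishing on every pattern whose `true`-set contains an edge of `T`,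
with balanced one-variable marginals — EXISTS IFF `T` IS 2-COLOURABLE (1), and every such `ω`
defeats every weight-insertion-invariant ("sieve-theoretic") deduction of the disjunction "some
edge `ij` of `T` has `n + h i`, `n + h j` both prime" relative to any input class that `ω`
satisfies (2); for the threshold target "at least `m` of the `k` forms prime" a ghost exists iff
`k + 2 ≤ 2m` (3), with the same schema (4). PROVED below (`TargetGraphParity_holds`); conjuncts
(1)–(2) are the retired route items `BipartiteCriterion` / `GhostSchema` (`stmt-Parity-4345`,
`stmt-Parity-4346`), (3) is `ManyPrimesThreshold` (`stmt-Parity-4349`).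

BARRIER
technique_class: sieve-theoretic linear-sieve-axioms weight-insertion-invariant type-I-discrepancy-bounds elliott-halberstam generalized-elliott-halberstam bounded-gaps disjunction-of-prime-pairs many-primes-in-tuples — `IsSieveTheoreticDeduction Inputs A` (`PrimePairParity.lean`): deductions of `∑ ν 1_A > 0` from distributional inputs (discrepancies (8.3) for `f ∈ {1, Λ, α ⋆ β}`, `q ≤ x^{1-ε}`, and main terms (8.4) — at any level: Bombieri–Vinogradov, `EH[ϑ]`, `GEH[ϑ]`) that "would be equally valid if one inserted a further non-negative weight `ω`" with the same weighted inputs (8.5)–(8.6) [cite: Polymath8b2014, §8 (8.3)–(8.6)], applied to a DISJUNCTION target `A = edgePrimeSet T h` (some edge of the target graph `T` on the `k` forms `n + h i` is a prime pair: the edge for `H₁ = 2`, the path `0–2–6` = `A'` for `H₁ ≤ 4`) or a THRESHOLD target `A = thresholdPrimeSet m h` (at least `m` of the `k` forms prime, the sets of `DHL[k, m]`) [cite: Polymath8b2014, §8 (8.7) and Claim 3.1]; the ghosts quantified over are the FIXED sign-pattern weights `ω = signPatternWeight P h`, `ω(n) = P([λ(n + h i) = -1]_i)`, `P ≥ 0`,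 killing the target patterns, with balanced one-variable marginals and positive mass (`HasSignGhost T`, `HasThresholdGhost k m`) — the form of the source's three printed weights [folklore].
blocks: in this frame, sieve-theoretic proofs at ANY level of distribution of "some edge of `T` is a prime pair infinitely often" for every BIPARTITE target graph `T` (`hasSignGhost_iff_colorable_two`, conjuncts (1)–(2)): the single edge = one prime pair `{n, n + d}` (twins `H₁ = 2`, the `d = 1, t = 2` slice `Literature.NumberTheory.Sieve.twinPrimeSystem` of `GeneralizedHardyLittlewood`; `edgePrimeSet_top_two`) and Polymath's path `0–2–6` = `A'` behind `H₁ ≤ 4` — "if the bound `H₁ ≤ 4` could be proven in a sieve-theoretic fashion, one should be able to conclude the bound (8.8), which is in direct contradiction to (8.9)", "The same arguments of course also prohibit a sieve-theoretic proof of the twin prime conjecture" [cite: Polymath8b2014, §8 (8.7)–(8.9) and p. 36] — and likewise every path, star, tree and even cycle (`hasSignGhost_of_star`, `hasSignGhost_cycleGraph_of_even`) [folklore]; and of "at least `m` of `k` forms prime" exactly when `k + 2 ≤ 2m` (`hasThresholdGhost_iff_add_two_le`, conjuncts (3)–(4): twins "2 of 2", "3 of 4", "`r + 1` of `2r`", "`r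 + 2` of `2r + 1`"), the sharp form in this frame of "the parity phenomenon means that we cannot hope to prove `k/2` of our linear functions are simultaneously prime based on a sieve argument" [cite: Maynard2019GapsICM, §6]. NOT blocked by any fixed sign ghost: every target graph with an odd cycle and every threshold `m ≤ ⌈k/2⌉` — the triangle "2 of `{n, n+2, n+6}`" behind `H₁ ≤ 6` (`not_hasSignGhost_top_three`, `not_hasThresholdGhost_three_two`), `K₅₀` with 2, `K₅₄` with 3, the pentagon `C₅` (`not_hasSignGhost_cycleGraph_five`), "3 of 5" (`not_hasThresholdGhost_five_three`); of these the source PROVES `DHL[50,2]` unconditionally, `DHL[54,3]` under `EH[ϑ]` and `DHL[3,2]`, `DHL[51,3]` under `GEH[ϑ]` [cite: Polymath8b2014, Theorem 3.2 (i), (vii), (xii), (xiii)].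
because: `λ(p) = -1` at primes, so for `n` in the target set the sign pattern `[λ(n + h i) = -1]_i` contains a target configuration (an edge of `T` inside its `true`-set, resp. `≥ m` trues) and `ω(n) = P(pattern) = 0`; hence `∑_{x ≤ n ≤ 2x} ν(n) 1_A(n) ω(n) = 0` for EVERY `ν ≥ 0` and every scale ("Observe that `ω` vanishes for any `n ∈ A'`, and hence `∑_n ν(n) 1_{A'}(n) ω(n) = 0` for any `ν`"), while a weight-insertion-invariant deduction fed the same inputs for `ω` would produce `> 0` (`signGhost_schema`, `thresholdGhost_schema`, conjuncts (2), (4)) [cite: Polymath8b2014, §8 (8.8)–(8.9)]; WHICH targets admit such a ghost is a finite linear programme: normalised to mass `1`, a ghost is a probability measure on `T`-independent `true`-sets with every vertex marginal `½` (balanced marginals), i.e. the point `(½, …, ½)` of the stable-set polytope of `T`; incidence vectors of stable sets obey the odd-circuit inequalities `x(C) ≤ (|C| - 1)/2` [cite: Toft1995HandbookColouring, §8, inequalities (a)–(d) before Thm 8.12], which `(½, …, ½)` violates on any odd circuit (formalised directly: along a closed walk of odd length `L` an independent `true`-set occupies `≤ (L-1)/2` positions but balanced marginals force the `P`-average `L/2`,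 `HasSignGhost.colorable_two`), whereas a proper 2-colouring `σ` gives the cut ghost `1[ε = σ] + 1[ε = ¬σ]` (`HasSignGhost.of_colorable_two`; for `n ≥ 1` Polymath's `1 - λ(n)λ(n+2)` and `(1 - λ(n)λ(n+2))(1 - λ(n+2)λ(n+6))` are `2×` and `4×` the cut ghosts of `K₂` and of the path) [folklore]; for thresholds, balanced marginals make the `P`-average number of trues `k/2` while the support has `≤ m - 1` trues, and conversely `1[#true < m ∧ #false < m]` is a flip-symmetric ghost iff `⌈k/2⌉ < m` (`hasThresholdGhost_iff_add_two_le`) [folklore].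
evasions_known: targets free of fixed sign ghosts that ARE proved by sieve methods: `DHL[50,2]` unconditionally (Bombieri–Vinogradov only), `DHL[54,3]` under `EH[ϑ]`, `DHL[3,2]` (whence `H₁ ≤ 6`) and `DHL[51,3]` under `GEH[ϑ]` [cite: Polymath8b2014, Theorem 3.2 (i), (vii), (xii), (xiii) and §1 (p. 3)]; "the parity barrier could be circumvented if one were able to introduce stronger sieve-theoretic axioms than the "linear" axioms currently available", e.g. bounds for bilinear sums `∑_d ∑_m α(d) β(m) 1_{[x,2x]}(dm) Λ(dm + 2)` — "Unfortunately, we do not know of any plausible way to control such bilinear expressions" (bilinear axioms exist elsewhere: Friedlander–Iwaniec, primes `a² + b⁴`) [cite: Polymath8b2014, §8 (p. 36)]; "the parity obstruction does not exclude the possibility that one could achieve (xii) just assuming `EH[ϑ]` rather than `GEH[ϑ]`" [cite: Polymath8b2014, §1 (p. 3)]; beyond parity "we do not know of general barriers", although weights formed by short divisor sums are not expected to do much better than `≈ log k` primes among `k` forms [cite: Maynard2019GapsICM, §6].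
scope_caveats: (a) as for `PrimePairParity`: §8 of the source is by its own account "somewhat informal and heuristic in nature" — that the ghost `ω` enjoys the same inputs as `ω = 1` rests on the Möbius randomness law (conjectural cancellation of `λ`-twisted sums in every progression to level `x^{1-ε}`), isolated here as the explicit hypothesis `Inputs ω`; the printed predictions are the registered unproved statements `Polymath2014_liouvilleShiftAPConjecture`, `Polymath2014_liouvillePairAP` of `PrimePairParity.lean` (no `_holds`, by design); nothing in this file asserts that any concrete input class contains a ghost [cite: Polymath8b2014, §8 (p. 35)]; (b) conjuncts (1), (3) classify FIXED sign-pattern ghosts with balanced one-variable marginals — the form of the source's weights for `H₁ = 2`, `H₁ ≤ 4` — not all conceivable non-negative weights; the source prints the edge, the path and the non-obstruction of `{0, 2, 6}`, NOT the general bipartite/threshold criterion, which is proved here and tagged folklore [cite: Polymath8b2014, §8]; (c) Remark 8.1 obstructs `A_H = {n : ∃ n ≤ p₁ < p₂ ≤ n + H both prime, p₂ - p₁ ≤ 4}` with the product weight `∏ (1 - λ(n+i)λ(n+i'))` over `0 ≤ i ≤ i' ≤ H`, `(n+i, 3) = (n+i', 3) = 1`, `i' - i ≤ 4` ("we leave the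 details to the interested reader"), a weight RESTRICTED by the residue of `n (mod 3)` and hence not a fixed sign-pattern weight; the fixed distance-`≤ 4` pair graph on `{0, …, H}` (`H ≥ 4`) contains the triangle `{0, 2, 4}` and has no fixed sign ghost by (1), so congruence-restricted ghosts (discarding, per residue class of `n`, forms forced composite) reach targets that conjunct (1) does not — (1) under-states the obstructed family for locally non-admissible configurations [cite: Polymath8b2014, Remark 8.1]; (d) freeness from fixed sign ghosts is no evidence of sieve-accessibility: Maynard's `k/2` sentence is informal and this file proves nothing in the converse direction [cite: Maynard2019GapsICM, §6]; (e) shifts are natural numbers `n + h i` (as in `SignGhost.lean`), not general affine forms, and `λ(0) = 0` makes the pattern "`[λ = -1]`" rather than a sign, immaterial at primes [folklore].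
status: established — PROVED here as a schema over every input class `Inputs` (`TargetGraphParity_holds`: finite combinatorics plus the weight-insertion schema of `PrimePairParity_holds`); the inputs for the twisted weights are conjectural (Möbius randomness) exactly as in the source [cite: Polymath8b2014, §8]. -/
def TargetGraphParity : Prop :=
  (∀ (k : ℕ) (T : SimpleGraph (Fin k)), HasSignGhost T ↔ T.Colorable 2) ∧
  (∀ (k : ℕ) (T : SimpleGraph (Fin k)) (h : Fin k → ℕ) (P : (Fin k → Bool) → ℝ),
      (∀ ε, 0 ≤ P ε) → (∀ ε, (∃ i j, T.Adj i j ∧ ε i = true ∧ ε j = true) → P ε = 0) →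
      ∀ Inputs : (ℕ → ℝ) → Prop,
        Inputs (fun n => P (fun i => decide (liouvilleR (n + h i) = -1))) →
        ¬ IsSieveTheoreticDeduction Inputs
            {n : ℕ | ∃ i j, T.Adj i j ∧ (n + h i).Prime ∧ (n + h j).Prime}) ∧
  (∀ k m : ℕ, HasThresholdGhost k m ↔ k + 2 ≤ 2 * m) ∧
  (∀ (k m : ℕ) (h : Fin k → ℕ) (P : (Fin k → Bool) → ℝ),
      (∀ ε, 0 ≤ P ε) → (∀ ε, m ≤ (univ.filter fun i => ε i = true).card → P ε = 0) →
      ∀ Inputs : (ℕ → ℝ) → Prop,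
        Inputs (fun n => P (fun i => decide (liouvilleR (n + h i) = -1))) →
        ¬ IsSieveTheoreticDeduction Inputs
            {n : ℕ | m ≤ (univ.filter fun i => (n + h i).Prime).card})

/-- **Proof of the barrier.** (1) `hasSignGhost_iff_colorable_two`; (2) `signGhost_schema`
(`signPatternWeight`, `edgePrimeSet` unfolded); (3) `hasThresholdGhost_iff_add_two_le`;
(4) `thresholdGhost_schema`. [cite: Polymath8b2014, §8 (8.8)–(8.9)] -/
theorem TargetGraphParity_holds : TargetGraphParity :=
  ⟨fun _ T => hasSignGhost_iff_colorable_two T,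
    fun k T h P hP hkill Inputs hIn => signGhost_schema k T h P hP hkill Inputs hIn,
    hasThresholdGhost_iff_add_two_le,
    fun k m h P hP hkill Inputs hIn => thresholdGhost_schema k m h P hP hkill Inputs hIn⟩

/-- Disjunctions do not help against parity as long as the target graph stays bipartite: e.g. the
star "`n + h 0` prime together with SOME other `n + h i`" (all edges through one vertex) is
obstructed for every `k`. [folklore] -/
theorem hasSignGhost_of_star {k : ℕ} (T : SimpleGraph (Fin (k + 1)))
    (hstar : ∀ i j, T.Adj i j → i = 0 ∨ j = 0) : HasSignGhost T := by
  classical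
  have C : T.Coloring Bool :=
    SimpleGraph.Coloring.mk (fun i => decide (i = 0)) fun {i j} hij => by
      have hne : i ≠ j := T.ne_of_adj hij
      rcases hstar i j hij with rfl | rfl
      · simpa using hne.symm
      · simpa using hne
  exact HasSignGhost.of_colorable_two (by simpa using C.colorable)

end Literature.Barriers.Parity
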